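import Summits.QuantumFields.YangMills.Theorems.UnitScaleTiltProp7CovLinAvgPureGauge
import Summits.QuantumFields.YangMills.Theorems.UnitScaleTiltProp7EmlFDerivConj
import Summits.QuantumFields.YangMills.Theorems.UnitScaleTiltProp7AvgTrueLinearisation
import HarnessLib

/-!
# Route `UnitScaleTilt`, crux K1 «MinimiserStabilityRegPr» (stmt-QuantumFields-19200), route-R [RP] curved ∕ (α) (AVG-SYM) operator junction —
# THE CURVED N6, FOURTH BRICK: THE TRUE ONE-STEP DERIVATIVE OF THE (0.4) AVERAGE ON A PURE GAUGE IS THE EXACT COARSE COVARIANT DIFFERENCE,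
# `D eml(W⁰)[i ↦ Y_ξ(loop_i)·W⁰_i]·κ₀* + κ₀·Y_ξ([y,y′])·κ₀* = ξ(emb c₋) − Ū₀^{(1)}(c)·ξ(emb c₊)·Ū₀^{(1)}(c)*`, `Ū₀^{(1)} = avgFun ℰp U₀` — the curved (1.20), NO defect

Cell `ym3-torus`, width seat `ym-ust-20520-w2` (g2); assembly of this seat's bricks 2–3 (✓ p602989 `…CovLinAvgPureGauge`, ⧗ p603216 `…EmlFDerivConj`) over ★p1 g4's true
one-step linearisation letters (`Prop7AvgTrueLinearisation.norm_avgFun_ratio_sub_one_sub_trueLin_le`: the linear operator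
`Y ↦ D eml(W⁰)[i ↦ Y_{U₀}(loop_i)·W⁰_i]·κ₀* + κ₀·Y_{U₀}([y,y′])·κ₀*`, written out — no definition).  THEOREMS ONLY (0 `def`, 0 `sorry`); `--supports stmt-QuantumFields-19200`,
count-neutral.  YM₃ on T³ is a ladder rung (R3), not the Clay problem; nothing here claims the curved N6, S2, P, the crux or the gap.

THE COMPUTATION.  For `Y_ξ(b) = ξ(b₋) − U₀,b ξ(b₊) U₀,b*`: `Y_ξ(loop_i) = ξ − W⁰_iξW⁰_i*` (brick 2), so `Y_ξ(loop_i)·W⁰_i = ξW⁰_i − W⁰_iξ` (`W*W = 1`); `D eml(W⁰)` maps this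
commutator direction to `ξκ₀ − κ₀ξ` (brick 3, `κ₀ = eml W⁰ = corr ℰp U₀ c` on the guard, `BlockAveragingEMLProp2.coe_avg_eq_eml`); and `Y_ξ([y,y′]) = ξ − Ū₀ξ′Ū₀*`
(brick 2, `Ū₀ = axialAvg U₀ c`); hence the sum is `(ξκ₀ − κ₀ξ)κ₀* + κ₀(ξ − Ū₀ξ′Ū₀*)κ₀* = ξ − (κ₀Ū₀)ξ′(κ₀Ū₀)*` (`κ₀κ₀* = 1`), and `κ₀Ū₀ = avgFun ℰp U₀ c` by definition.
This is the derivative of the EXACT gauge covariance `avgFun(g·U₀)(c) = g(emb c₋)·avgFun(U₀)(c)·g(emb c₊)⁻¹` ([Balaban1985Averaging] (11), tree `BlockAveraging.avgFun_covariant`),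
obtained here by direct computation on the linearised letters.

WHAT IS PROVED (ns `…Theorems.Prop7TrueLinPureGauge`).
* `loopSum_mul_loopHol_eq_comm` — `Y_ξ(loop_i)·W⁰_i = ξ·W⁰_i − W⁰_i·ξ`;
* `coe_corr_eq_eml` — on the guard `dist1(W⁰_i) < δ_N`: `corr ℰp U₀ c = eml W⁰` (★p1 g4's step, isolated);
* ★★ `trueLin_pureGauge` — the title identity, hypotheses: `∀ i, dist1 (loopHol U₀ c i) < deltaSU n` (the (0.4) guard at `c`).
HONEST SCOPE.  One step, one coarse bond; the `k`-fold statement (the curved `iterLambda_grad`) iterates this along the background tower (next brick ∕ routeR-w1's (R-A)).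

References: T. Bałaban, CMP 98 (1985) 17–51 [Balaban1985Averaging] ((11) p.19, (124) p.36); CMP 95 (1984) 17–40 [Balaban1984PropagatorsI] ((1.20) p.20); CMP 109 (1987) 249–301
[Balaban1987RG1] ((0.4)–(0.6) p.253).
-/

noncomputable section

open scoped BigOperators Matrix.Norms.L2Operator

namespace Summit.QuantumFields.YangMills.Theorems.Prop7TrueLinPureGauge

open Literature.MathematicalPhysics.QuantumFieldTheory.Balaban1983to89
open Finset T4Continuum BlockAveraging AveragingRT ExpMeanLog BlockAveragingEMLLinearised BlockAveragingEMLLinearisedBackground BlockAveragingEMLProp2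
open Summit.QuantumFields.YangMills.Theorems.Prop7HolRatioPerStep (norm_coe_eq_one norm_star_coe_eq_one coe_star_mul_self coe_mul_star_self)
open Summit.QuantumFields.YangMills.Theorems.Prop7CovLinAvgPureGauge (covWalkSum_pureGauge_loop covWalkSum_pureGauge_segment)
open Summit.QuantumFields.YangMills.Theorems.Prop7EmlFDerivConj (fderiv_eml_comm)

variable {P : Params} {n : Type*} [Fintype n] [DecidableEq n] [Nonempty n] {j : ℕ}

/-- `Y_ξ(loop_i)·W⁰_i = ξW⁰_i − W⁰_iξ`: the loop sum of a pure gauge times the loop variable is the commutator direction. [cite: Balaban1987RG1, (0.6) p.253] -/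
theorem loopSum_mul_loopHol_eq_comm (U₀ : GaugeField P j (Matrix.specialUnitaryGroup n ℂ)) (ξ : Site P j → Matrix n n ℂ) (c : PBond P (j + 1)) (i : Idx P) :
    covWalkSum U₀ (fun b : PBond P j => ξ b.src - ((U₀ b : Matrix.specialUnitaryGroup n ℂ) : Matrix n n ℂ) * ξ b.tgt *
        star ((U₀ b : Matrix.specialUnitaryGroup n ℂ) : Matrix n n ℂ)) (walk (emb c.src) (loopWord P.L c.dir (off i.1) i.2.1 i.2.2))
        * ((loopHol U₀ c i : Matrix.specialUnitaryGroup n ℂ) : Matrix n n ℂ)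
      = ξ (emb c.src) * ((loopHol U₀ c i : Matrix.specialUnitaryGroup n ℂ) : Matrix n n ℂ)
        - ((loopHol U₀ c i : Matrix.specialUnitaryGroup n ℂ) : Matrix n n ℂ) * ξ (emb c.src) := by
  rw [covWalkSum_pureGauge_loop, sub_mul, mul_assoc, mul_assoc, coe_star_mul_self, mul_one]

/-- On the (0.4) guard at `c` the background's correction factor IS `exp[mean log]` of its loop family (★p1 g4's identification, isolated).
[cite: Balaban1987RG1, (0.4) p.253] -/
theorem coe_corr_eq_eml (U₀ : GaugeField P j (Matrix.specialUnitaryGroup n ℂ)) (c : PBond P (j + 1))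
    (hsmall : ∀ i : Idx P, dist1 (loopHol U₀ c i) < deltaSU n) :
    ((corr (expMeanLogSU (n := n)) U₀ c : Matrix.specialUnitaryGroup n ℂ) : Matrix n n ℂ)
      = eml fun i : Idx P => ((loopHol U₀ c i : Matrix.specialUnitaryGroup n ℂ) : Matrix n n ℂ) := by
  have hS : Small (expMeanLogSU (n := n)) U₀ c := hsmall
  unfold corr
  rw [if_pos hS, coe_avg_eq_eml _ hsmall]

/-- ★★ **THE TRUE ONE-STEP DERIVATIVE OF THE (0.4) AVERAGE ON A PURE GAUGE IS THE EXACT COARSE COVARIANT DIFFERENCE**: on the (0.4) guard at `c`,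
`D eml(W⁰)[i ↦ Y_ξ(loop_i)·W⁰_i]·κ₀* + κ₀·Y_ξ([y,y′])·κ₀* = ξ(emb c₋) − Ū₀^{(1)}(c)·ξ(emb c₊)·Ū₀^{(1)}(c)*` with `Ū₀^{(1)} = avgFun ℰp U₀` — the curved (1.20) for the TRUE
linearisation, with no `α`-defect (contrast `Prop7CovLinAvgPureGauge.covLinAvg_pureGauge` for the main-term (124)). [cite: Balaban1985Averaging, (11) p.19, (124) p.36] -/
theorem trueLin_pureGauge (U₀ : GaugeField P j (Matrix.specialUnitaryGroup n ℂ)) (ξ : Site P j → Matrix n n ℂ) (c : PBond P (j + 1))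
    (hsmall : ∀ i : Idx P, dist1 (loopHol U₀ c i) < deltaSU n) :
    fderiv ℂ (eml : (Idx P → Matrix n n ℂ) → Matrix n n ℂ) (fun i => ((loopHol U₀ c i : Matrix.specialUnitaryGroup n ℂ) : Matrix n n ℂ))
          (fun i => covWalkSum U₀ (fun b : PBond P j => ξ b.src - ((U₀ b : Matrix.specialUnitaryGroup n ℂ) : Matrix n n ℂ) * ξ b.tgt *
              star ((U₀ b : Matrix.specialUnitaryGroup n ℂ) : Matrix n n ℂ)) (walk (emb c.src) (loopWord P.L c.dir (off i.1) i.2.1 i.2.2))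
            * ((loopHol U₀ c i : Matrix.specialUnitaryGroup n ℂ) : Matrix n n ℂ))
          * star ((corr (expMeanLogSU (n := n)) U₀ c : Matrix.specialUnitaryGroup n ℂ) : Matrix n n ℂ)
        + ((corr (expMeanLogSU (n := n)) U₀ c : Matrix.specialUnitaryGroup n ℂ) : Matrix n n ℂ)
          * covWalkSum U₀ (fun b : PBond P j => ξ b.src - ((U₀ b : Matrix.specialUnitaryGroup n ℂ) : Matrix n n ℂ) * ξ b.tgt *
              star ((U₀ b : Matrix.specialUnitaryGroup n ℂ) : Matrix n n ℂ)) (walk (emb c.src) (List.replicate P.L (c.dir, true)))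
          * star ((corr (expMeanLogSU (n := n)) U₀ c : Matrix.specialUnitaryGroup n ℂ) : Matrix n n ℂ)
      = ξ (emb c.src) - ((avgFun (expMeanLogSU (n := n)) U₀ c : Matrix.specialUnitaryGroup n ℂ) : Matrix n n ℂ) * ξ (emb c.tgt) *
          star ((avgFun (expMeanLogSU (n := n)) U₀ c : Matrix.specialUnitaryGroup n ℂ) : Matrix n n ℂ) := by
  -- the direction is the commutator family
  have hdir : (fun i : Idx P => covWalkSum U₀ (fun b : PBond P j => ξ b.src - ((U₀ b : Matrix.specialUnitaryGroup n ℂ) : Matrix n n ℂ) * ξ b.tgt *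
        star ((U₀ b : Matrix.specialUnitaryGroup n ℂ) : Matrix n n ℂ)) (walk (emb c.src) (loopWord P.L c.dir (off i.1) i.2.1 i.2.2))
          * ((loopHol U₀ c i : Matrix.specialUnitaryGroup n ℂ) : Matrix n n ℂ))
      = fun i : Idx P => ξ (emb c.src) * ((loopHol U₀ c i : Matrix.specialUnitaryGroup n ℂ) : Matrix n n ℂ)
          - ((loopHol U₀ c i : Matrix.specialUnitaryGroup n ℂ) : Matrix n n ℂ) * ξ (emb c.src) :=
    funext fun i => loopSum_mul_loopHol_eq_comm U₀ ξ c i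
  -- `eml` is differentiable at the loop family (guard ⇒ within `1` of `1`)
  have hW1 : ∀ i : Idx P, ‖((loopHol U₀ c i : Matrix.specialUnitaryGroup n ℂ) : Matrix n n ℂ) - 1‖ < 1 := by
    intro i
    rw [← FederbushMean.dist1_SU_eq]
    exact (lt_third_of_lt_deltaSU (hsmall i)).trans (by norm_num)
  have hD := fderiv_eml_comm (fun i : Idx P => ((loopHol U₀ c i : Matrix.specialUnitaryGroup n ℂ) : Matrix n n ℂ)) (differentiableAt_eml hW1) (ξ (emb c.src))
  have hκ := coe_corr_eq_eml U₀ c hsmall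
  rw [hdir, hD, covWalkSum_pureGauge_segment, ← hκ]
  -- `(ξκ₀ − κ₀ξ)κ₀* + κ₀(ξ − Ū₀ξ′Ū₀*)κ₀* = ξ − (κ₀Ū₀)ξ′(κ₀Ū₀)*`
  have hκκ := coe_mul_star_self (corr (expMeanLogSU (n := n)) U₀ c)
  have havg : ((avgFun (expMeanLogSU (n := n)) U₀ c : Matrix.specialUnitaryGroup n ℂ) : Matrix n n ℂ)
      = ((corr (expMeanLogSU (n := n)) U₀ c : Matrix.specialUnitaryGroup n ℂ) : Matrix n n ℂ)
        * ((axialAvg U₀ c : Matrix.specialUnitaryGroup n ℂ) : Matrix n n ℂ) := by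
    rw [avgFun, Submonoid.coe_mul]
  rw [havg, star_mul]
  set κ : Matrix n n ℂ := ((corr (expMeanLogSU (n := n)) U₀ c : Matrix.specialUnitaryGroup n ℂ) : Matrix n n ℂ)
  set a : Matrix n n ℂ := ((axialAvg U₀ c : Matrix.specialUnitaryGroup n ℂ) : Matrix n n ℂ)
  calc (ξ (emb c.src) * κ - κ * ξ (emb c.src)) * star κ + κ * (ξ (emb c.src) - a * ξ (emb c.tgt) * star a) * star κ
      = ξ (emb c.src) * (κ * star κ) - κ * a * ξ (emb c.tgt) * (star a * star κ) := by noncomm_ring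
    _ = ξ (emb c.src) - κ * a * ξ (emb c.tgt) * (star a * star κ) := by rw [hκκ, mul_one]

end Summit.QuantumFields.YangMills.Theorems.Prop7TrueLinPureGauge

end
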